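import Literature.AlgebraicGeometry.Frobenioids.ArithmeticFrobenioidNonDilating
import Literature.AlgebraicGeometry.Frobenioids.PerfectionStandardTypes
import Literature.AnabelianGeometry.EtaleTheta.Discharge.Sec3CuspidallyPureOfPfImage
import Literature.AnabelianGeometry.EtaleTheta.Discharge.Sec3Prop34iConnectedOfGaloisCovering

/-!
# [EtTh] Def. 3.6 (ii) / Ex. 3.9 (iii) «`Φ_W^ell` is … non-dilating»: for EVERY tempered Frobenioid with `Φ = im(Φ₀^pf → Φ₀^rlf)` over the
# weak Def. 3.6 (i) data, [FrdI] Def. 1.1 (i) non-dilation of the pull-back along an endomorphism is REDUCED to `Φ₀` (proof-only)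

S. Mochizuki, *The geometry of Frobenioids I*, Kyushu J. Math. **62** (2008) [MochizukiFrdI2008], Def. 1.1 (i) p. 19: an endomorphism of a
monoid is *non-dilating* if "`φ(a) ≼ a` for all primary `a`" forces it to be the identity (on `M/M^×`); S. Mochizuki, *The étale theta
function …*, Publ. RIMS **45** (2009) [MochizukiEtTh2009], Example 3.9 (iii) p. 310 (PDF p. 84): "`Φ_W^ell` is … perf-factorial, non-dilating
[cf. Proposition 3.4, (i) …], and cuspidally pure"; Def. 3.6 (ii) p. 303 (PDF p. 77).  [cite: MochizukiFrdI2008, Def. 1.1 (i) p.19]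
[cite: MochizukiEtTh2009, Ex 3.9 p.84]

abc-iut cell, block C, abc-iut-L2-lead R889/R917 row «DEF36v-PURITY@FULL-BASE», FILE 3 part (G) (seat abc-iut-f-128, gen 5): the bridge
`Example39Data.example39_iv_cuspidallyPure_ofInducedSquare_ofTempered` (abc-iut-w6-d047, p482977) producing F-0615 at an Example 3.9 datum over
a genuine base from a cuspidally pure tempered Frobenioid `C` needs the two (iii)-clauses a `TemperedFrobenioid` does not carry: `Φ` perfect and
`hnd : ∀ A f, V.IsNonDilating (Φ(A)) (Φ.pull f)`; at the multi-object models of record (ℤ-tower, `Ÿ`-skeleton) only pull-backs acting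
TRIVIALLY on `Φ₀` were known non-dilating (abc-iut-w5-d179's `…isNonDilating_of_trivial`).  PROOF-ONLY companion (0 definitions) of FILE 1
`Discharge/Sec3CuspidallyPureOfPfImage.lean` (same binder `hΦ`), abc-iut-L2-t3 / abc-iut-L6-t12's `ofRlfZWeak` / `rlfFunctorWeak`
(`rlfMapWeak_toRealification_of`), abc-iut-L1's `isNonDilating_of_forall_isPrimary` and perfection calculus.  Nothing landed is edited.

WHAT IS PROVED — for ANY tempered Frobenioid `C` over `ofRlfZWeak dm hpf` with `Φ(A) = im(Φ₀(Y_A)^pf → Φ₀(Y_A)^rlf)` (`hΦ`) and any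
endomorphism `f` of `A`, writing `ψ := Φ₀(base f) : Φ₀(Y_A) → Φ₀(Y_A)`:
* `TemperedFrobenioid.isPerfect_Φ_of_pfImage` — `Φ(A)` is perfect (the `hperf` input of the bridge, generically);
* `TemperedFrobenioid.coe_pull_toR` — the pull-back acts on `ι(m)` by `ι(ψ m)`;
* `TemperedFrobenioid.isPrimary_toR_of_isPrimary` — primality ASCENDS: `m` primary in `Φ₀(Y_A)` ⇒ `ι(m)` primary in `Φ(A)` (converse of
  FILE 1's descent);
* **`TemperedFrobenioid.isNonDilating_pull_of_pfImage`** — [FrdI] Def. 1.1 (i) for `Φ.pull f` ⟸ the `Φ₀`-LEVEL statement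
  `h0 : (∀ m primary, ψ m ≼ m) → ψ = id`: if every primary `a ∈ Φ(A)` has `pull a ≼ a`, then every primary `m` has `ι(ψ m) ≼ ι(m)`, i.e.
  `ψ m ≼ m` (`Perfection.of_precsim_of_iff` through `Φ(A) ≅ Φ₀(Y_A)^pf`), so `ψ = id`, so `pull` fixes every `ι(m)`, hence every
  `x` (`xⁿ = ι(m)`, `n`-th powers injective in the perfect sharp `Φ(A)`);
* engines: `isNonDilating_pull_ofDiagonalBase`, `isNonDilating_pull_ofGenDiagonalBase` (binder: `Φ₀(F f)` non-dilating), and at the models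
  over the full base **`ThetaTowerTempered.isNonDilating_pull`** WITH NO HYPOTHESIS (the `Ÿ`-skeleton with cusps; at the ℤ-tower this is
  abc-iut-w5-d179's `ZTowerTempered.isNonDilating`, not restated) — the `Φ₀`-level input IS abc-iut-w6-d058's Prop. 3.4 (i) theorem
  `GaloisAction.isNonDilating_phiZeroPull` (`Discharge/Sec3Prop34iConnectedOfGaloisCovering.lean`).

HONEST LABEL: theorems over CONSTRUCTED data (the ℤ-tower / `Ÿ`-skeleton are combinatorial consistency witnesses, not formal schemes);
[FrdI]/[EtTh] are refereed; nothing here bears on [IUTchIII] Cor. 3.12 — no side is taken; typed ≠ proved for anything else.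
-/

noncomputable section

namespace Literature.AnabelianGeometry.EtaleTheta

open CategoryTheory Opposite Function Literature.AlgebraicGeometry.Frobenioids Literature.AnabelianGeometry.SemiGraphs

universe u₀ v₀ u v w

namespace TemperedFrobenioid

section PfImage

variable {D₀ : Type u₀} [Category.{v₀} D₀] {dm : DivisorMonoids.{u₀, v₀, w} D₀}
  {hpf : ∀ Y : D₀ᵒᵖ, IsPerfFactorialCof (dm.Φ₀.obj Y)}
  {D : Type u} [Category.{v} D] {VD : FrdICatStub.{u, v, w} D}
  (C : TemperedFrobenioid (RealifiedDivisorMonoids.ofRlfZWeak dm hpf) D VD)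

/-- **The pull-back along `f` acts on `ι(m)` by `ι(Φ₀(f) m)`** (`Φ₀^ℝ` is functorial over `Φ₀^pf`, abc-iut-L2-t3's `rlfMapWeak`).
[cite: MochizukiEtTh2009, Def 3.6 p.76] -/
theorem coe_pull_toR {A B : Dᵒᵖ} (f : A ⟶ B) (m : dm.Φ₀.obj (C.baseOp A))
    (hm : ((hpf (C.baseOp A)).weak.toRealification (Perfection.of _ m) : C.ΦRlog.obj A) ∈ C.Φ.carrier A) :
    ((C.Φ.pull f ⟨_, hm⟩ : C.Φ.carrier B) : C.ΦRlog.obj B) =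
      (hpf (C.baseOp B)).weak.toRealification (Perfection.of _ ((dm.Φ₀.map (C.base.map f.unop).op).hom m)) :=
  rlfMapWeak_toRealification_of dm.Φ₀ hpf (C.base.map f.unop).op m

variable (hΦ : ∀ (A : Dᵒᵖ) (x : C.ΦRlog.obj A),
    x ∈ C.Φ.carrier A ↔ ∃ a : Perfection (dm.Φ₀.obj (C.baseOp A)), (hpf (C.baseOp A)).weak.toRealification a = x)

include hΦ

/-- `Φ(A) = im(Φ₀^pf → Φ₀^rlf)` is perfect (image of a perfection under an injective homomorphism). [cite: MochizukiEtTh2009, Ex 3.9 p.84] -/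
theorem isPerfect_Φ_of_pfImage (A : Dᵒᵖ) : IsPerfect (C.Φ.carrier A) := by
  refine ⟨fun n hn => ⟨fun x y hxy => ?_, fun y => ?_⟩⟩
  · exact Subtype.ext (((IsPerfFactorialWeak.Rlf.isPerfect (hpf (C.baseOp A)).weak).bijective_pow n hn).1
      (congrArg Subtype.val hxy))
  · obtain ⟨a, ha⟩ := (hΦ A _).mp y.2
    obtain ⟨b, hb⟩ := (isPerfect_perfection.bijective_pow n hn).2 a
    refine ⟨⟨_, C.toRealification_mem hΦ A b⟩, Subtype.ext ?_⟩
    show (hpf (C.baseOp A)).weak.toRealification b ^ n = (y : C.ΦRlog.obj A)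
    rw [← map_pow]
    exact (congrArg _ hb).trans ha

/-- **Primality ASCENDS from `Φ₀` to `Φ(A)`**: if `m` is primary in `Φ₀(Y_A)` then `ι(m)` is primary in `Φ(A)` (converse of FILE 1's
`isPrimary_of_eq_toRealification_mk`; `Φ(A) ≅ Φ₀(Y_A)^pf` and abc-iut-L1's `Perfection.isPrimary_of_iff`). [cite: MochizukiFrdI2008, §0 p.12] -/
theorem isPrimary_toR_of_isPrimary (A : Dᵒᵖ) {m : dm.Φ₀.obj (C.baseOp A)} (hm : IsPrimary m) :
    IsPrimary (⟨_, C.toRealification_mem hΦ A (Perfection.of _ m)⟩ : C.Φ.carrier A) := by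
  have hsharp : IsSharp (dm.Φ₀.obj (C.baseOp A)) := (hpf (C.baseOp A)).weak.isDivisorial.isSharp
  have hι := PfImageWeak.toRealification_injective (hpf (C.baseOp A)).weak
  have hof : IsPrimary (Perfection.of _ m) := (Perfection.isPrimary_of_iff hsharp).mpr hm
  refine ⟨fun h => hof.1 (hι ((congrArg Subtype.val h).trans (map_one _).symm)), fun b hb hba => ?_⟩
  obtain ⟨d, hd⟩ := (hΦ A _).mp b.2
  have hbe : b = ⟨_, C.toRealification_mem hΦ A d⟩ := Subtype.ext hd.symm
  subst hbe
  have hd1 : d ≠ 1 := fun h => hb (Subtype.ext (by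
    show (hpf (C.baseOp A)).weak.toRealification d = 1
    rw [h, map_one]))
  -- `d ≼ of m` in the perfection
  have hdm : d ≼ Perfection.of _ m := by
    obtain ⟨N, hN, z, hz⟩ := hba
    obtain ⟨c, hc⟩ := (hΦ A _).mp z.2
    refine ⟨N, hN, c, hι ?_⟩
    rw [map_pow, map_mul, hc]
    exact congrArg Subtype.val hz
  -- primality of `of m`: `of m ≼ d`
  obtain ⟨K, hK, c, hc⟩ := hof.2 d hd1 hdm
  refine ⟨K, hK, ⟨_, C.toRealification_mem hΦ A c⟩, Subtype.ext ?_⟩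
  show (hpf (C.baseOp A)).weak.toRealification d ^ K =
    (hpf (C.baseOp A)).weak.toRealification (Perfection.of _ m) * (hpf (C.baseOp A)).weak.toRealification c
  rw [← map_pow, hc, map_mul]

/-- **[FrdI] Def. 1.1 (i) for the pull-back `Φ(f) : Φ(A) → Φ(A)` along an endomorphism `f`, REDUCED TO `Φ₀`**: if the induced
endomorphism `ψ := Φ₀(base f)` of `Φ₀(Y_A)` is non-dilating, so is `Φ(f)`.  (If every primary `a ∈ Φ(A)` has `Φ(f) a ≼ a`, then every
primary `m ∈ Φ₀(Y_A)` has `ι(ψ m) = Φ(f) ι(m) ≼ ι(m)`, i.e. `ψ m ≼ m`; so `ψ = id` (sharp `Φ₀`), so `Φ(f)` fixes every `ι(m)`, hence every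
`x` — `xⁿ = ι(m)` and `n`-th powers are injective in `Φ(A)`.) [cite: MochizukiFrdI2008, Def. 1.1 (i) p.19] -/
theorem isNonDilating_pull_of_pfImage (A : Dᵒᵖ) (f : A ⟶ A)
    (h0 : IsNonDilating (dm.Φ₀.map (C.base.map f.unop).op).hom) :
    treeMonoidVocabWeak.{w}.IsNonDilating (C.Φ.carrier A) (C.Φ.pull f) := by
  have hsharp : IsSharp (dm.Φ₀.obj (C.baseOp A)) := (hpf (C.baseOp A)).weak.isDivisorial.isSharp
  -- `Φ(A) ⊆ Φ₀^ℝ(Y_A)` is sharp (a submonoid of the sharp realification)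
  have hsharpΦ : IsSharp (C.Φ.carrier A) := ⟨fun _ ha => Subtype.ext
    ((IsPerfFactorialWeak.Rlf.isSharp (hpf (C.baseOp A)).weak).1 _ (ha.map (C.Φ.carrier A).subtype))⟩
  change IsNonDilating (C.Φ.pull f)
  refine isNonDilating_of_forall_isPrimary hsharpΦ _ fun H => ?_
  -- Step 1: `ψ = id` on `Φ₀(Y_A)`
  have hψ : (dm.Φ₀.map (C.base.map f.unop).op).hom = MonoidHom.id _ :=
    h0.eq_id_of_isSharp hsharp fun m hm => by
      have h := H _ (C.isPrimary_toR_of_isPrimary hΦ A hm)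
      -- `Φ(f) ι(m) = ι(ψ m)` and `ι(ψ m) ≼ ι(m)` descends to the perfection
      obtain ⟨N, hN, z, hz⟩ := h
      obtain ⟨c, hc⟩ := (hΦ A _).mp z.2
      apply Perfection.of_precsim_of_iff.mp
      refine ⟨N, hN, c, PfImageWeak.toRealification_injective (hpf (C.baseOp A)).weak ?_⟩
      rw [map_pow, map_mul, hc, ← C.coe_pull_toR f m (C.toRealification_mem hΦ A _)]
      exact congrArg Subtype.val hz
  -- Step 2: `Φ(f)` fixes every `ι(m)`, hence every `x` (`xⁿ = ι(m)`)
  refine MonoidHom.ext fun x => ?_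
  rw [MonoidHom.id_apply]
  obtain ⟨m, n, hxm⟩ := C.exists_eq_toRealification_mk hΦ A x
  have hperf := C.isPerfect_Φ_of_pfImage hΦ A
  have hxe : x = ⟨_, C.toRealification_mem hΦ A (Perfection.mk m n)⟩ := Subtype.ext hxm
  subst hxe
  apply (hperf.bijective_pow n n.pos).1
  show C.Φ.pull f _ ^ (n : ℕ) = _ ^ (n : ℕ)
  have hxn : (⟨_, C.toRealification_mem hΦ A (Perfection.mk m n)⟩ : C.Φ.carrier A) ^ (n : ℕ) =
      ⟨_, C.toRealification_mem hΦ A (Perfection.of _ m)⟩ := Subtype.ext (by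
    show (hpf (C.baseOp A)).weak.toRealification (Perfection.mk m n) ^ (n : ℕ) =
      (hpf (C.baseOp A)).weak.toRealification (Perfection.of _ m)
    rw [← map_pow, Perfection.mk_pow_self])
  rw [← map_pow, hxn]
  apply Subtype.ext
  rw [C.coe_pull_toR f m, hψ, MonoidHom.id_apply]

end PfImage

section Diagonal

variable {D₀ : Type u₀} [Category.{v₀} D₀] {dm : DivisorMonoids.{u₀, v₀, 0} D₀}
  (hpf : ∀ Y : D₀ᵒᵖ, IsPerfFactorialCof (dm.Φ₀.obj Y)) {D : Type u} [Category.{v} D]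
  (hD : IsConnected D) (hD' : IsTotallyEpimorphic D) (hFSM : IsOfFSMType D) (R S : (Dᵒᵖ ⥤ CommMonCat.{0}) → Prop)

/-- [FrdI] Def. 1.1 (i) for abc-iut-w5-d179's `ofDiagonalBase` along any endomorphism whose `Φ₀`-pull-back is non-dilating.
[cite: MochizukiFrdI2008, Def. 1.1 (i) p.19] -/
theorem isNonDilating_pull_ofDiagonalBase (P : DiagonalBase dm D) (A : Dᵒᵖ) (f : A ⟶ A)
    (h0 : IsNonDilating (dm.Φ₀.map (P.F.map f.unop).op).hom) :
    treeMonoidVocabWeak.{0}.IsNonDilating ((ofDiagonalBase hpf P hD hD' hFSM R S).Φ.carrier A)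
      ((ofDiagonalBase hpf P hD hD' hFSM R S).Φ.pull f) :=
  (ofDiagonalBase hpf P hD hD' hFSM R S).isNonDilating_pull_of_pfImage (fun _ _ => Iff.rfl) A f h0

/-- [FrdI] Def. 1.1 (i) for abc-iut-L2-t3's `ofGenDiagonalBase` along any endomorphism whose `Φ₀`-pull-back is non-dilating.
[cite: MochizukiFrdI2008, Def. 1.1 (i) p.19] -/
theorem isNonDilating_pull_ofGenDiagonalBase (P : GenDiagonalBase dm D) (A : Dᵒᵖ) (f : A ⟶ A)
    (h0 : IsNonDilating (dm.Φ₀.map (P.F.map f.unop).op).hom) :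
    treeMonoidVocabWeak.{0}.IsNonDilating ((ofGenDiagonalBase hpf P hD hD' hFSM R S).Φ.carrier A)
      ((ofGenDiagonalBase hpf P hD hD' hFSM R S).Φ.pull f) :=
  (ofGenDiagonalBase hpf P hD hD' hFSM R S).isNonDilating_pull_of_pfImage (fun _ _ => Iff.rfl) A f h0

end Diagonal

end TemperedFrobenioid

/-! ### The models over the full base `B^temp(Π^tp_X)⁰`: `Φ₀(f)` IS non-dilating (abc-iut-w6-d058's Prop. 3.4 (i) theorem) -/

/-! (At abc-iut-w5-d179's ℤ-tower the conclusion is already in the tree — `ZTowerTempered.isNonDilating`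
(`BiKummerThm44HypOfGaloisCoveringZTowerAll.lean`, primary-ray dichotomy); it is not restated here.  The generic route of this file
would give it as `isNonDilating_pull_ofDiagonalBase … (GaloisAction.isNonDilating_phiZeroPull _ _ _)`.) -/

namespace ThetaTowerTempered

variable {K : Type} [Field K] (X : SemiGraphs.TemperedArithmeticGroup.{0} K) (φ : X.Pi →* Multiplicative ℤ)
  (R S : ((ConnectedPart (BTemp X.Pi))ᵒᵖ ⥤ CommMonCat.{0}) → Prop)

/-- **Example 3.9 (iii) «non-dilating» at abc-iut-L2-t3's `Ÿ`-skeleton WITH CUSPS over `B^temp(Π^tp_X)⁰`, with NO hypothesis**: the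
pull-back of `Φ` along EVERY endomorphism of EVERY connected tempered covering is non-dilating — the `hnd` input of abc-iut-w6-d047's
Example 3.9 bridge. [cite: MochizukiEtTh2009, Ex 3.9 p.84] -/
theorem isNonDilating_pull (A : (ConnectedPart (BTemp X.Pi))ᵒᵖ) (f : A ⟶ A) :
    treeMonoidVocabWeak.{0}.IsNonDilating ((temperedFrobenioid X φ R S).Φ.carrier A) ((temperedFrobenioid X φ R S).Φ.pull f) :=
  TemperedFrobenioid.isNonDilating_pull_ofGenDiagonalBase (hpf X φ) _ _ _ R S (genDiagonalBase X φ) A f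
    (LogDivisorModel.GaloisAction.isNonDilating_phiZeroPull _ _ _)

end ThetaTowerTempered

end Literature.AnabelianGeometry.EtaleTheta

end
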